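import Mathlib
import Summits.MatrixMultiplication.MatrixMultiplication.Theorems.SnSubsetDichotomyPolynomialSlackHubRowKept

/-!
# The kept value of the hub rows, summed (3/4 step)

Crux `Summit.MatrixMultiplication.MatrixMultiplication.Theses.SnSubsetDichotomy.PolynomialSlack`
(item `stmt-MatrixMultiplication-8306`), level-one programme, line transport-split-hull (lead c10).
`hubRow_kept_le` summed over a set `R` of hub rows (U-positions) with a common mask `Qm`: the level data
`σ σ' x ρ ρ' y Ψ` are now functions of the position `k`, and the per-position slop is summed using
`Σ_a σ' k a ≤ Σ_j dB(j,k) = 1`, `Σ_b ρ' k b = Σ_{i ∉ Qm, heavy} dC(k,i) ≤ 1`, `R_k = Σ_{i∉Qm} pC(k,i) ≤ Σ_b ρ' k b`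
and `Σ_{k ∈ R} Σ_{i ∉ Qm, heavy} dC(k,i) ≤ Λ'`:
`Σ_{k∈R} slop_k ≤ (2ε₂ + 5(1+log n)ε₁ + 1/n) Λ' + |R| (4 ε₁ m + 4 m² h₁ + 4 m²/M + 5 (1+log n) ε₁)`
(`m = ⌊log₂ n²⌋ + 1` the number of levels).  Stated for a general triple and mask, it serves both the
original triple (rows `R`, mask `Q`) and the reversed triple `(U,T,S)` (rows `Q`, mask `∅`).
-/

namespace Summit.MatrixMultiplication.MatrixMultiplication.Theorems.PolynomialSlack

open scoped BigOperators
open Literature.Combinatorics.Additive (TripleProductProperty)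

set_option linter.dupNamespace false

/-! ## Two abstract bookkeeping facts -/

/-- **The per-row slop, uniformised.** With `0 ≤ X ≤ 1` (heavy column mass), `R ≤ Y`, `0 ≤ Y ≤ 1`
(kept and heavy masked row masses) the slop of `hubRow_kept_le` is at most
`(2ε₂ + 5Gε₁ + 1/n)·Y + (4ε₁m + 4m²h₁ + 4m²/M + 5Gε₁)`. [folklore] -/
theorem rowsKept_slop_le (ε₁ ε₂ h₁ M m G nR X Y R : ℝ) (hε₁ : 0 ≤ ε₁) (hε₂ : 0 ≤ ε₂)
    (hh₁ : 0 ≤ h₁) (hM : 0 < M) (hm : 0 ≤ m) (hG : 0 ≤ G) (hn : 0 < nR) (hX0 : 0 ≤ X)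
    (hX1 : X ≤ 1) (hY0 : 0 ≤ Y) (hY1 : Y ≤ 1) (hRY : R ≤ Y) :
    ε₂ * (X * Y) + 2 * ε₁ * m * (X + Y) + 2 * (X + Y) * ((m * m) * h₁) + (X + Y) ^ 2 * (m * m) / M +
        (ε₂ * R + 5 * G * ε₁ * (R + 1) + R / nR) ≤
      (2 * ε₂ + 5 * G * ε₁ + 1 / nR) * Y +
        (4 * ε₁ * m + 4 * (m * m) * h₁ + 4 * (m * m) / M + 5 * G * ε₁) := by
  have hXY : X * Y ≤ Y := mul_le_of_le_one_left hY0 hX1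
  have hS2 : X + Y ≤ 2 := by linarith
  have hS0 : 0 ≤ X + Y := by linarith
  have hsq : (X + Y) ^ 2 ≤ 4 := by nlinarith
  have hmm : 0 ≤ m * m := mul_nonneg hm hm
  have h1 : ε₂ * (X * Y) ≤ ε₂ * Y := mul_le_mul_of_nonneg_left hXY hε₂
  have h2 : 2 * ε₁ * m * (X + Y) ≤ 4 * ε₁ * m := by nlinarith [mul_nonneg hε₁ hm]
  have h3 : 2 * (X + Y) * ((m * m) * h₁) ≤ 4 * (m * m) * h₁ := by
    nlinarith [mul_nonneg hmm hh₁]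
  have h4 : (X + Y) ^ 2 * (m * m) / M ≤ 4 * (m * m) / M :=
    div_le_div_of_nonneg_right (mul_le_mul_of_nonneg_right hsq hmm) hM.le
  have h5 : ε₂ * R ≤ ε₂ * Y := mul_le_mul_of_nonneg_left hRY hε₂
  have h6 : 5 * G * ε₁ * (R + 1) ≤ 5 * G * ε₁ * Y + 5 * G * ε₁ := by
    nlinarith [mul_nonneg hG hε₁]
  have h7 : R / nR ≤ Y / nR := div_le_div_of_nonneg_right hRY hn.le
  have e : (2 * ε₂ + 5 * G * ε₁ + 1 / nR) * Y = ε₂ * Y + ε₂ * Y + 5 * G * ε₁ * Y + Y / nR := by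
    ring
  rw [e]
  linarith

/-- **Summing per-row bounds.** If `L k ≤ 5/8 · A k + (c · Y k + d)` for every `k`, `0 ≤ c` and
`Σ_R Y ≤ Λ'`, then `Σ_R L ≤ 5/8 · Σ_R A + (c Λ' + |R| d)`. [folklore] -/
theorem rowsKept_sum_le {ι : Type*} (R : Finset ι) (L A Y : ι → ℝ) (c d Λ' : ℝ) (hc : 0 ≤ c)
    (hk : ∀ k, L k ≤ 5 / 8 * A k + (c * Y k + d)) (hΛ : ∑ k ∈ R, Y k ≤ Λ') :
    ∑ k ∈ R, L k ≤ 5 / 8 * ∑ k ∈ R, A k + (c * Λ' + (R.card : ℝ) * d) := by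
  calc ∑ k ∈ R, L k ≤ ∑ k ∈ R, (5 / 8 * A k + (c * Y k + d)) :=
        Finset.sum_le_sum fun k _ => hk k
    _ = 5 / 8 * ∑ k ∈ R, A k + (c * ∑ k ∈ R, Y k + (R.card : ℝ) * d) := by
        rw [Finset.sum_add_distrib, Finset.sum_add_distrib, ← Finset.mul_sum, ← Finset.mul_sum,
          Finset.sum_const, nsmul_eq_mul]
    _ ≤ 5 / 8 * ∑ k ∈ R, A k + (c * Λ' + (R.card : ℝ) * d) := by
        have := mul_le_mul_of_nonneg_left hΛ hc
        linarith

/-! ## The stub -/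

/-- **Kept value of the hub rows, summed: at most `5/8` of the cost of the included levels plus slop.** [folklore] -/
theorem rows_kept_le {n : ℕ} (hn : 2 ≤ n) (B : ℕ) (hB : ∀ S' T' U' : Finset (Equiv.Perm (Fin (n - 1))), TripleProductProperty S' T' U' → S'.card * T'.card * U'.card ≤ B) {S T U : Finset (Equiv.Perm (Fin n))} (hTPP : TripleProductProperty S T U) (hS0 : S.Nonempty) (hT0 : T.Nonempty) (hU0 : U.Nonempty) (dA dB dC pB pC : Fin n → Fin n → ℝ) (hdA : ∀ i j, dA i j = (((S ×ˢ T).filter fun st => st.2 j = st.1 i).card : ℝ) / (S.card * T.card : ℕ)) (hdB : ∀ j k, dB j k = (((T ×ˢ U).filter fun tu => tu.2 k = tu.1 j).card : ℝ) / (T.card * U.card : ℕ)) (hdC : ∀ k i, dC k i = (((U ×ˢ S).filter fun us => us.2 i = us.1 k).card : ℝ) / (U.card * S.card : ℕ)) (θC : ℝ) (hθC : 16 / (n : ℝ) ≤ θC) (hpB : ∀ j k, pB j k = if 16 / (n : ℝ) ≤ dB j k then dB j k - 1 / n else 0) (hpC : ∀ k i, pC k i = if θC ≤ dC k i then dC k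 i - 1 / n else 0) (ε₁ ε₂ h₁ M A₀ P W A₁ : ℝ) (hε₁ : 0 < ε₁) (hε₂ : 0 < ε₂) (hε₂1 : ε₂ ≤ 1) (hε₁n : 32 ≤ ε₁ * (n : ℝ) ^ (245 / 1000 : ℝ)) (hh₁ : 0 < h₁) (hP0 : 0 ≤ P) (hM : 56 * (((⌊Real.logb 2 ((n : ℝ) ^ 2)⌋₊ + 1 : ℕ) : ℝ) * ((⌊Real.logb 2 ((n : ℝ) ^ 2)⌋₊ + 1 : ℕ) : ℝ)) ≤ M) (hA₀ : 5000 * n * (1 + Real.log n) * Real.log (4 * ((n.factorial : ℝ) / (S.card * T.card : ℕ)) / ε₂) / ε₂ ^ 2 ≤ A₀) (hA₀n : (n : ℝ) ≤ A₀) (hA₀log : Real.log A₀ ≤ 101 / 100 * Real.log n) (hA₁ : 124 / 100 * Real.log n ≤ Real.log A₁) (hA₀₁ : A₀ ≤ A₁) (hPlow : A₀ ^ 2 * (n : ℝ) ^ (-(151 / 100 : ℝ)) ≤ P * ε₁ ^ 2) (hW : 10 ^ 7 * (1 + Real.log n) ^ 2 * (Real.log (4 * ((n.factorial : ℝ) /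 (S.card * T.card : ℕ)) / ε₂)) ^ 2 * n * B / (ε₂ ^ 4 * h₁ ^ 2) + 20 * (1 + M) * A₀ ^ 2 * B / (h₁ ^ 2 * n) + n * P * B + 20 * (1 + M) * A₁ ^ 2 * B / (h₁ ^ 2 * n) ≤ W) (hN : W < ((S.card * T.card * U.card : ℕ) : ℝ)) (Qm : Finset (Fin n)) (R : Finset (Fin n)) (Λ' : ℝ) (σ σ' x ρ ρ' y : Fin n → Fin (⌊Real.logb 2 ((n : ℝ) ^ 2)⌋₊ + 1) → ℝ) (hσ : ∀ k a, σ k a = ∑ j ∈ Finset.univ.filter (fun j => 16 / (n : ℝ) ≤ dB j k ∧ ⌊Real.logb 2 (1 / dB j k)⌋₊ = a.val), pB j k) (hσ' : ∀ k a, σ' k a = ∑ j ∈ Finset.univ.filter (fun j => 16 / (n : ℝ) ≤ dB j k ∧ ⌊Real.logb 2 (1 / dB j k)⌋₊ = a.val), dB j k) (hx : ∀ k a, x k a = max (((Finset.univ.filter (fun j => 16 / (n : ℝ) ≤ dB j k ∧ ⌊Real.logb 2 (1 / dB j k)⌋₊ = a.val)).card : ℝ)) 1) (hρ : ∀ k b,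 ρ k b = ∑ i ∈ Finset.univ.filter (fun i => i ∉ Qm ∧ θC ≤ dC k i ∧ ⌊Real.logb 2 (1 / dC k i)⌋₊ = b.val), pC k i) (hρ' : ∀ k b, ρ' k b = ∑ i ∈ Finset.univ.filter (fun i => i ∉ Qm ∧ θC ≤ dC k i ∧ ⌊Real.logb 2 (1 / dC k i)⌋₊ = b.val), dC k i) (hy : ∀ k b, y k b = max (((Finset.univ.filter (fun i => i ∉ Qm ∧ θC ≤ dC k i ∧ ⌊Real.logb 2 (1 / dC k i)⌋₊ = b.val)).card : ℝ)) 1) (Ψ : Fin n → Fin (⌊Real.logb 2 ((n : ℝ) ^ 2)⌋₊ + 1) → Fin (⌊Real.logb 2 ((n : ℝ) ^ 2)⌋₊ + 1) → ℝ) (hΨ : ∀ k a b, Ψ k a b = ∑ i ∈ Finset.univ.filter (fun i => i ∉ Qm ∧ θC ≤ dC k i ∧ ⌊Real.logb 2 (1 / dC k i)⌋₊ = b.val), ∑ j ∈ Finset.univ.filter (fun j => 16 / (n : ℝ) ≤ dB j k ∧ ⌊Real.logb 2 (1 / dB j k)⌋₊ = a.val), dA i j * pB j k * pC k i) (hΛ'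 : ∑ k ∈ R, ∑ i ∈ Finset.univ.filter (fun i => i ∉ Qm), (if θC ≤ dC k i then dC k i else 0) ≤ Λ') : ∑ k ∈ R, ((n : ℝ) - 1) * ∑ i ∈ Finset.univ.filter (fun i => i ∉ Qm), pC k i * ∑ j : Fin n, dB j k * (1 / n - dA i j) ≤ 5 / 8 * (∑ k ∈ R, ((∑ a, if ε₁ ≤ σ k a ∧ ∃ b, ε₁ ≤ ρ k b ∧ Ψ k a b ≤ (1 - ε₂) * (σ k a * ρ k b) / n then σ' k a * (1 - Real.log (x k a) / Real.log n) else 0) + (∑ b, if ε₁ ≤ ρ k b ∧ ∃ a, ε₁ ≤ σ k a ∧ Ψ k a b ≤ (1 - ε₂) * (σ k a * ρ k b) / n then ρ' k b * (1 - Real.log (y k b) / Real.log n) else 0))) + ((2 * ε₂ + 5 * (1 + Real.log n) * ε₁ + 1 / n) * Λ' + (R.card : ℝ) * (4 * ε₁ * ((⌊Real.logb 2 ((n : ℝ) ^ 2)⌋₊ + 1 : ℕ) : ℝ) + 4 * (((⌊Real.logb 2 ((n : ℝ) ^ 2)⌋₊ + 1 : ℕ) : ℝ) * ((⌊Real.logb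 2 ((n : ℝ) ^ 2)⌋₊ + 1 : ℕ) : ℝ)) * h₁ + 4 * (((⌊Real.logb 2 ((n : ℝ) ^ 2)⌋₊ + 1 : ℕ) : ℝ) * ((⌊Real.logb 2 ((n : ℝ) ^ 2)⌋₊ + 1 : ℕ) : ℝ)) / M + 5 * (1 + Real.log n) * ε₁)) := by
  have hn0 : 0 < n := by omega
  have hn1 : 1 ≤ n := by omega
  have hnR : (0 : ℝ) < n := by exact_mod_cast hn0
  have h1n : (0 : ℝ) ≤ 1 / n := by positivity
  -- (0) positivity of the parameters: `m ≥ 1 > 0`, `M ≥ 56 m² > 0`, `G = 1 + log n ≥ 0`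
  have hmpos : (0 : ℝ) < ((⌊Real.logb 2 ((n : ℝ) ^ 2)⌋₊ + 1 : ℕ) : ℝ) := by
    exact_mod_cast Nat.succ_pos _
  have hm0 := hmpos.le
  have hMpos : 0 < M := lt_of_lt_of_le (mul_pos (by norm_num) (mul_pos hmpos hmpos)) hM
  have hG : 0 ≤ 1 + Real.log n := add_nonneg zero_le_one (Real.log_natCast_nonneg n)
  have hcoef : 0 ≤ 2 * ε₂ + 5 * (1 + Real.log n) * ε₁ + 1 / n :=
    add_nonneg (add_nonneg (mul_nonneg zero_le_two hε₂.le)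
      (mul_nonneg (mul_nonneg (by norm_num) hG) hε₁.le)) h1n
  -- (1) the profiles: `0 ≤ dB ≤ 1`, `Σ_j dB(j,k) = 1`, `0 ≤ dC ≤ 1`, `Σ_i dC(k,i) = 1`, `pC ≤ dC·1[heavy]`
  have hdB0 : ∀ j k, 0 ≤ dB j k := fun j k => by rw [hdB]; positivity
  have hdB1 : ∀ j k, dB j k ≤ 1 := fun j k => by rw [hdB]; exact pairDensity_le_one T U _
  have hdBsum : ∀ k, ∑ j, dB j k = 1 := fun k => by
    simp_rw [hdB]
    rw [← Finset.sum_div, ← Nat.cast_sum, sum_pairMarginal_fst T U k]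
    exact div_self (by exact_mod_cast (Nat.mul_pos hT0.card_pos hU0.card_pos).ne')
  have hdC0 : ∀ k i, 0 ≤ dC k i := fun k i => by rw [hdC]; positivity
  have hdC1 : ∀ k i, dC k i ≤ 1 := fun k i => by rw [hdC]; exact pairDensity_le_one U S _
  have hdCsum : ∀ k, ∑ i, dC k i = 1 := fun k => by
    simp_rw [hdC]
    rw [← Finset.sum_div, ← Nat.cast_sum, sum_pairMarginal_snd U S k]
    exact div_self (by exact_mod_cast (Nat.mul_pos hU0.card_pos hS0.card_pos).ne')
  have hg0 : ∀ k i, (0 : ℝ) ≤ (if θC ≤ dC k i then dC k i else 0) := fun k i => by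
    split_ifs
    · exact hdC0 k i
    · exact le_rfl
  have hgle : ∀ k i, (if θC ≤ dC k i then dC k i else 0) ≤ dC k i := fun k i => by
    split_ifs
    · exact le_rfl
    · exact hdC0 k i
  have hpCle : ∀ k i, pC k i ≤ (if θC ≤ dC k i then dC k i else 0) := fun k i => by
    rw [hpC k i]
    split_ifs
    · exact sub_le_self _ h1n
    · exact le_rfl
  -- (2) the heavy column mass `X_k = Σ_a σ' k a ∈ [0, 1]`
  have hXeq : ∀ k, ∑ a, σ' k a = ∑ j, (if 16 / (n : ℝ) ≤ dB j k then dB j k else 0) := fun k => by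
    rw [sum_eq_sum_levels_of_vanish hn1 (fun j => dB j k) (16 / (n : ℝ)) le_rfl (fun j => hdB1 j k)
      (fun j => if 16 / (n : ℝ) ≤ dB j k then dB j k else 0) (fun j hj => if_neg hj)]
    refine Finset.sum_congr rfl fun a _ => ?_
    rw [hσ' k a]
    refine Finset.sum_congr rfl fun j hj => ?_
    simp only [Finset.mem_filter, Finset.mem_univ, true_and] at hj
    rw [if_pos hj.1]
  have hX0 : ∀ k, 0 ≤ ∑ a, σ' k a := fun k => by
    rw [hXeq k]
    refine Finset.sum_nonneg fun j _ => ?_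
    split_ifs
    · exact hdB0 j k
    · exact le_rfl
  have hX1 : ∀ k, ∑ a, σ' k a ≤ 1 := fun k => by
    rw [hXeq k]
    refine le_of_le_of_eq (Finset.sum_le_sum fun j _ => ?_) (hdBsum k)
    split_ifs
    · exact le_rfl
    · exact hdB0 j k
  -- (3) the heavy masked row mass `Y_k = Σ_b ρ' k b = Σ_{i ∉ Qm} dC·1[heavy] ∈ [0, 1]`, and `R_k ≤ Y_k`
  have hYeq : ∀ k, ∑ b, ρ' k b =
      ∑ i ∈ Finset.univ.filter (fun i => i ∉ Qm), (if θC ≤ dC k i then dC k i else 0) := fun k => by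
    rw [sum_offMask_eq_sum_levels_of_vanish hn1 (fun i => dC k i) θC hθC (fun i => hdC1 k i) Qm
      (fun i => if θC ≤ dC k i then dC k i else 0) (fun i hi => if_neg hi)]
    refine Finset.sum_congr rfl fun b _ => ?_
    rw [hρ' k b]
    refine Finset.sum_congr rfl fun i hi => ?_
    simp only [Finset.mem_filter, Finset.mem_univ, true_and] at hi
    rw [if_pos hi.2.1]
  have hY0 : ∀ k, 0 ≤ ∑ b, ρ' k b := fun k => by
    rw [hYeq k]
    exact Finset.sum_nonneg fun i _ => hg0 k i
  have hY1 : ∀ k, ∑ b, ρ' k b ≤ 1 := fun k => by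
    rw [hYeq k]
    exact le_of_le_of_eq ((Finset.sum_le_univ_sum_of_nonneg (hg0 k)).trans
      (Finset.sum_le_sum fun i _ => hgle k i)) (hdCsum k)
  have hRY : ∀ k, ∑ i ∈ Finset.univ.filter (fun i => i ∉ Qm), pC k i ≤ ∑ b, ρ' k b := fun k => by
    rw [hYeq k]
    exact Finset.sum_le_sum fun i _ => hpCle k i
  have hsumY : ∑ k ∈ R, ∑ b, ρ' k b ≤ Λ' := (Finset.sum_congr rfl fun k _ => hYeq k).trans_le hΛ'
  -- (4) the per-row bound `hubRow_kept_le` at every hub row `k`, with the level data `σ k, …, Ψ k`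
  have hrow := fun k => hubRow_kept_le hn B hB hTPP hS0 hT0 hU0 dA dB dC pB pC hdA hdB hdC θC hθC
    hpB hpC ε₁ ε₂ h₁ M A₀ P W A₁ hε₁ hε₂ hε₂1 hε₁n hh₁ hP0 hM hA₀ hA₀n hA₀log hA₁ hA₀₁ hPlow hW hN
    k Qm (σ k) (σ' k) (x k) (ρ k) (ρ' k) (y k) (hσ k) (hσ' k) (hx k) (hρ k) (hρ' k) (hy k) (Ψ k)
    (hΨ k)
  -- (5) uniformise the per-row slop and sum over `R`
  refine rowsKept_sum_le R _ _ (fun k => ∑ b, ρ' k b) _ _ Λ' hcoef (fun k => ?_) hsumY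
  exact (hrow k).trans ((add_assoc _ _ _).le.trans (add_le_add le_rfl (rowsKept_slop_le _ _ _ _ _ _ _
    _ _ _ hε₁.le hε₂.le hh₁.le hMpos hm0 hG hnR (hX0 k) (hX1 k) (hY0 k) (hY1 k) (hRY k))))

end Summit.MatrixMultiplication.MatrixMultiplication.Theorems.PolynomialSlack
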